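import Mathlib

/-!
# Crux triage r1-1 (gen 2) — proofs of two typed first lemmas of ideator 2

Verbatim restatements (same text as `Cruxes/PeriodicIRBound/IdeatorSketch2.lean`, which only
needs `Mathlib` for these two `Prop`s) of

* `GramPencilTolerance` — card `gram-pencil-tangency`, the ROBUST half (typed, previously
  unproved; random-tested by the ideator and by triage gen 1). PROVED here: the determinant
  condition gives `|A s − 2Bp − (e₁−e₂)| ≤ ε'`, hence `A s − E ≤ 2Bp`; if `A s − E ≥ 0`, squaring
  against Gram `4B²p² ≤ B²(s²−1)` gives `ε²s² − 2AEs + E² + B² ≤ 0`, whose larger root is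
  `(AE + B√(E²−ε²))/ε²`; if `A s − E < 0` the bound is immediate from `ε ≤ A`.
* `PhaseExtraction` — card `fsum-phase-pencil` (independent re-proof; gen 1 proved it too).
-/

noncomputable section

set_option maxHeartbeats 400000

namespace Summit.AtomisticToContinuum.BoseEinsteinCondensation.Cruxes.PeriodicIRBound.TriageR1K1

/-- Verbatim copy of `Ideator2.GramPencilTolerance`. -/
def GramPencilTolerance : Prop :=
  ∀ A B n p e₁ e₂ e₃ : ℝ, 0 < B → B < A → 0 ≤ n →
    p ^ 2 ≤ n * (n + 1) →
    0 ≤ B * p - A * n + e₁ →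
    0 ≤ A * (n + 1) - B * p + e₂ →
    (B / 2 - e₃) ^ 2 ≤ (B * p - A * n + e₁) * (A * (n + 1) - B * p + e₂) →
    let ε := Real.sqrt (A ^ 2 - B ^ 2)
    let ε' := Real.sqrt ((A + e₁ + e₂) ^ 2 - (B - 2 * e₃) ^ 2)
    let E := (e₁ - e₂) + ε'
    ε ≤ E →
    ε ^ 2 * (2 * n + 1) ≤ A * E + B * Real.sqrt (E ^ 2 - ε ^ 2)

/-- Verbatim copy of `Ideator2.PhaseExtraction`. -/
def PhaseExtraction : Prop :=
  ∀ N N₀ k F Yd pi minc : ℝ, 0 < k → 0 < N₀ → 0 ≤ N → 0 ≤ Yd → 0 ≤ pi →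
    F = N * k ^ 2 →
    (k ^ 2 * N₀ * pi - minc) ^ 2 ≤ F * Yd →
    pi ≤ Real.sqrt (N * Yd) / (N₀ * k) + |minc| / (N₀ * k ^ 2)

/-- **The robust Gram–pencil lemma holds.** -/
theorem gramPencilTolerance_holds : GramPencilTolerance := by
  intro A B n p e₁ e₂ e₃ hB hBA hn hgram _hd1 _hd2 hdet
  dsimp only
  intro hE
  set ε := Real.sqrt (A ^ 2 - B ^ 2) with hεdef
  set R := (A + e₁ + e₂) ^ 2 - (B - 2 * e₃) ^ 2 with hRdef
  set ε' := Real.sqrt R with hε'def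
  set E := e₁ - e₂ + ε' with hEdef
  have hA : 0 < A := hB.trans hBA
  have hAB2 : 0 < A ^ 2 - B ^ 2 := by nlinarith
  have hεpos : 0 < ε := Real.sqrt_pos.mpr hAB2
  have hεsq : ε ^ 2 = A ^ 2 - B ^ 2 := Real.sq_sqrt hAB2.le
  have hε2A2 : ε ^ 2 ≤ A ^ 2 := by rw [hεsq]; nlinarith [sq_nonneg B]
  -- s = 2n+1, u = A s - 2 B p - (e₁ - e₂)
  set s := 2 * n + 1 with hs
  have hs1 : 1 ≤ s := by rw [hs]; linarith
  set u := A * s - 2 * B * p - (e₁ - e₂) with hu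
  -- determinant identity ⇒ u² ≤ R
  have hprod : (B * p - A * n + e₁) * (A * (n + 1) - B * p + e₂) =
      ((A + e₁ + e₂) ^ 2 - u ^ 2) / 4 := by
    rw [hu, hs]; ring
  have h4 : 4 * (B / 2 - e₃) ^ 2 = (B - 2 * e₃) ^ 2 := by ring
  have huR : u ^ 2 ≤ R := by
    rw [hprod] at hdet
    rw [hRdef]
    linarith [hdet, h4]
  have hR0 : 0 ≤ R := le_trans (sq_nonneg u) huR
  have hule : u ≤ ε' := by
    have h1 : |u| ≤ ε' := by
      rw [hε'def, ← Real.sqrt_sq_eq_abs]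
      exact Real.sqrt_le_sqrt huR
    exact (le_abs_self u).trans h1
  -- hence A s - E ≤ 2 B p
  have hkey : A * s - E ≤ 2 * B * p := by
    have : u = A * s - 2 * B * p - (e₁ - e₂) := hu
    rw [hEdef]; linarith
  -- Gram: (2Bp)² ≤ B²(s² - 1)
  have hgram' : (2 * B * p) ^ 2 ≤ B ^ 2 * (s ^ 2 - 1) := by
    have : s ^ 2 - 1 = 4 * (n * (n + 1)) := by rw [hs]; ring
    rw [this]
    nlinarith [hgram, sq_nonneg B]
  -- D = √(E² - ε²)
  have hE0 : 0 ≤ E := hεpos.le.trans hE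
  have hD2 : 0 ≤ E ^ 2 - ε ^ 2 := by nlinarith [hE, hεpos]
  set D := Real.sqrt (E ^ 2 - ε ^ 2) with hDdef
  have hD0 : 0 ≤ D := Real.sqrt_nonneg _
  have hDsq : D ^ 2 = E ^ 2 - ε ^ 2 := Real.sq_sqrt hD2
  have hBD : 0 ≤ B * D := mul_nonneg hB.le hD0
  by_cases hcase : 0 ≤ A * s - E
  · -- square: (A s - E)² ≤ (2Bp)² ≤ B²(s²-1) ⇒ ε²s² - 2AEs + E² + B² ≤ 0
    have hsq : (A * s - E) ^ 2 ≤ B ^ 2 * (s ^ 2 - 1) := by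
      have h0 : (A * s - E) ^ 2 ≤ (2 * B * p) ^ 2 := by
        rw [sq, sq]; exact mul_self_le_mul_self hcase hkey
      exact h0.trans hgram'
    have hquad : ε ^ 2 * s ^ 2 - 2 * A * E * s + E ^ 2 + B ^ 2 ≤ 0 := by
      have : ε ^ 2 * s ^ 2 - 2 * A * E * s + E ^ 2 + B ^ 2 =
          (A * s - E) ^ 2 - B ^ 2 * (s ^ 2 - 1) := by rw [hεsq]; ring
      rw [this]; linarith
    -- conclude ε² s ≤ AE + BD
    by_contra hlt
    have hlt' : A * E + B * D < ε ^ 2 * s := not_le.mp hlt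
    have hpos1 : 0 < ε ^ 2 * s - A * E - B * D := by linarith
    have hpos2 : 0 < ε ^ 2 * s - A * E + B * D := by linarith
    have hmul := mul_pos hpos1 hpos2
    have hid : (ε ^ 2 * s - A * E - B * D) * (ε ^ 2 * s - A * E + B * D) =
        ε ^ 2 * (ε ^ 2 * s ^ 2 - 2 * A * E * s + E ^ 2 + B ^ 2) := by
      linear_combination (-B ^ 2) * hDsq + (-E ^ 2) * hεsq
    have hnp : ε ^ 2 * (ε ^ 2 * s ^ 2 - 2 * A * E * s + E ^ 2 + B ^ 2) ≤ 0 :=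
      mul_nonpos_of_nonneg_of_nonpos (sq_nonneg ε) hquad
    rw [hid] at hmul
    linarith
  · have hcase' : A * s < E := by linarith [not_le.mp hcase]
    -- A s < E ⇒ ε² s ≤ A (A s) < A E ≤ A E + B D
    have h1 : ε ^ 2 * s ≤ A * (A * s) := by
      have hs0 : 0 ≤ s := by linarith
      nlinarith [hε2A2, hs0]
    have h2 : A * (A * s) < A * E := mul_lt_mul_of_pos_left hcase' hA
    linarith

/-- **Phase extraction holds** (arithmetic of the `{ρ_k, Y_k}` determinant condition). -/
theorem phaseExtraction_holds : PhaseExtraction := by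
  intro N N₀ k F Yd pi minc hk hN₀ _hN _hYd _hpi hF hdet
  have hk2 : 0 < k ^ 2 := by positivity
  have hN₀k : 0 < N₀ * k := mul_pos hN₀ hk
  have hN₀k2 : 0 < N₀ * k ^ 2 := mul_pos hN₀ hk2
  have habs : |k ^ 2 * N₀ * pi - minc| ≤ Real.sqrt (F * Yd) := by
    rw [← Real.sqrt_sq_eq_abs]
    exact Real.sqrt_le_sqrt hdet
  have hsqrt : Real.sqrt (F * Yd) = k * Real.sqrt (N * Yd) := by
    rw [hF, show N * k ^ 2 * Yd = k ^ 2 * (N * Yd) by ring, Real.sqrt_mul (sq_nonneg k),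
      Real.sqrt_sq hk.le]
  have h1 : k ^ 2 * N₀ * pi - minc ≤ k * Real.sqrt (N * Yd) := by
    rw [← hsqrt]; exact (le_abs_self _).trans habs
  have h2 : k ^ 2 * N₀ * pi ≤ k * Real.sqrt (N * Yd) + |minc| := by
    linarith [le_abs_self minc]
  have h3 : pi ≤ (k * Real.sqrt (N * Yd) + |minc|) / (N₀ * k ^ 2) := by
    rw [le_div_iff₀ hN₀k2]; linarith
  have h4 : k * Real.sqrt (N * Yd) / (N₀ * k ^ 2) = Real.sqrt (N * Yd) / (N₀ * k) := by
    rw [div_eq_div_iff hN₀k2.ne' hN₀k.ne']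
    ring
  rw [add_div, h4] at h3
  exact h3

end Summit.AtomisticToContinuum.BoseEinsteinCondensation.Cruxes.PeriodicIRBound.TriageR1K1

end
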